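import Mathlib.Analysis.SpecialFunctions.Pow.Real
import Mathlib.MeasureTheory.Function.LpSeminorm.Basic
import Literature.Analysis.FluidPDE.AnomalousDissipation
import Literature.Analysis.FluidPDE.PassiveScalar
import Literature.Analysis.FunctionSpaces.TorusTestFunction
import HarnessLib

/-!
# The `2½`-dimensional (planar) theorems of Bruè–De Lellis 2023, §3 (Theorems 3.1, 3.2)

Topic `Analysis/FluidPDE`; the §3 companion of `AnomalousDissipation.lean` (**turb.S10** =
`brue_deLellis_anomalous_dissipation`, Thm. 1.1) and `AnomalousDissipationEnhanced.lean`
(`BrueDeLellis2023_enhancedDissipation`, Thm. 1.2), whose vocabulary (`IsVanishingViscosity`,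
`FunctionSpaces.Torus.IsClassicalNSSolutionOn`, `FunctionSpaces.eBoundedHolderNorm`,
`FunctionSpaces.ContinuousInHolderOn`, `Torus.IsClassicalScalarTransportOn`, `Torus.scalarDissipation`,
`FunctionSpaces.Torus.HasWeakPartialDeriv`) is reused, never redeclared.

E. Bruè, C. De Lellis, *Anomalous dissipation for the forced 3D Navier–Stokes equations*, Comm. Math.
Phys. 400 (2023) 1507–1533 = arXiv:2207.06301 (v1 of 13 Jul 2022, the only arXiv version; held as
`paper:arxiv-2207.06301`). All locators are those of the arXiv v1 PDF, page-confirmed 2026-08-26 on a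
render of that PDF: §3 "Strategy of the proof", §3.1 "The (2+½)-dimensional flow" with the ansatz (3.1),
the planar system ((2+½)-NS), the `ν`-independent data (3.2)–(3.3), **Theorem 3.1** with (3.4),
**Theorem 3.2** with (3.5) and Remark 3.3 with (3.6), all on p. 6. The source introduces them by "We will
now state more precise versions of Theorem 1.1 and Theorem 1.2": the solutions of Thms. 1.1/1.2 on `T³`
are the `2½`-dimensional lifts `u = (v, θ)`, `p = (q, 0)`, `f = (g, 0)` ((3.1)) of a planar forced
Navier–Stokes solution `v` and of the passive scalar `θ` it transports with the same viscosity: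

  `∂ₜv + (v·∇)v + ∇q = νΔv + g`, `div v = 0`, `∂ₜθ + v·∇θ = νΔθ` on `T² × [0,1]`,
  `v(·,0) = v₀`, `θ(·,0) = θ₀` ((2+½)-NS), (3.2)–(3.3)).

## Contents

* `BrueDeLellis2023_thm31` — **named fact**, Theorem 3.1 as printed (planar anomalous dissipation of
  the transported scalar, forces `g^{ν_m} → g` in `C([0,1]; C^α(T²))` for every `α ∈ (0,1)`).
* `BrueDeLellis2023_thm32` — **named fact**, Theorem 3.2 as printed (forces `g^{ν_m} → g` in
  `C([0,1]; W^{1,p}(T²))` for every `p < ∞`, dissipation `≥ C exp{−log^{3/2}(1/ν_m)}`, (3.5)).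
The lift of Theorem 3.1 to the `T³` statement of Theorem 1.1 (`brue_deLellis_anomalous_dissipation`)
is proved in the sibling file `AnomalousDissipationTwoHalfDLift.lean` (it needs the `2½`-dimensional
packaging `Torus.isClassicalNSSolutionOn_twoHalf` and the Hölder bookkeeping of the tree).

## Design choices (faithfulness notes)

* Planar objects live on `UnitAddTorus (Fin 2)` with values in `EuclideanSpace ℝ (Fin 2)` (velocity,
  force) and `ℝ` (scalar, pressure); "`g^{ν_m} ∈ C^∞(T² × [0,1])`" is
  `FunctionSpaces.Torus.IsSmoothSpaceTimeOn (Icc 0 1) (g m)`; "the smooth solution `v^{ν_m}, θ^m` to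
  ((2+½)-NS)" with the data (3.2)–(3.3) is a classical forced Navier–Stokes solution
  `FunctionSpaces.Torus.IsClassicalNSSolutionOn (Icc 0 1) (ν m) (g m) (v m) (q m)` on `T²` with
  `v m 0 = v₀` together with a classical solution `Torus.IsClassicalScalarTransportOn (Icc 0 1) (ν m) (v m) (θ m)`
  of the advection–diffusion equation with `θ m 0 = θ₀` (`PassiveScalar.lean`). The definite article
  ("the smooth solution") refers to the uniqueness of smooth solutions of both (linear resp. 2D)
  problems from smooth data; the facts assert existence of the classical pair and do not restate
  uniqueness (weaker, as in `brue_deLellis_anomalous_dissipation`).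
* `ν_m ↓ 0` is `IsVanishingViscosity ν` (strictly decreasing, positive, `→ 0`), as in Thms. 1.1/1.2 of
  the tree; in Theorem 3.2 additionally `ν m < 1` (pass to a tail), so that `log(1/ν_m) > 0` and the
  real power `log^{3/2}(1/ν_m) = Real.rpow (Real.log (1/ν m)) (3/2)` is the honest one.
* (3.4) `liminf_m ν_m ∫₀¹∫_{T²} |∇θ^{ν_m}|² dx dt > 0` is typed in the junk-free `ε`-form
  `∃ ε > 0, ∀ᶠ m, ε ≤ Torus.scalarDissipation (ν m) (θ m) 0 1` (`= ν_m ∫₀¹ ‖∇θ_m(t)‖²_{L²(T²)} dt`), the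
  scalar twin of `HasAnomalousDissipation`.
* Theorem 3.1 (1), "`g ∈ ⋂_{α∈(0,1)} C([0,1]; C^α(T²))` such that `g^{ν_m} → g` in `C([0,1]; C^α(T²))`
  for any `α ∈ (0,1)`": a limit `gLim : ℝ → T² → ℝ²` with `gLim t ∈ C^{0,α}_b` for `t ∈ [0,1]`,
  `t ↦ gLim t` continuous on `[0,1]` in the `C^{0,α}` norm (`FunctionSpaces.ContinuousInHolderOn`), and
  `sup_{t∈[0,1]} ‖g_m(t) − gLim(t)‖_{C^{0,α}} → 0` (`⨆ t ∈ Icc 0 1, eBoundedHolderNorm α (g m t - gLim t)`, in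
  `ℝ≥0∞`), for every `α ∈ (0,1)`; `‖·‖_{C^{0,α}} = ‖·‖_∞ + [·]_α` for the product (sup) metric of
  `UnitAddTorus (Fin 2) = Fin 2 → AddCircle 1`, equivalent to the flat one (`HolderNorm.lean`).
* Theorem 3.2 (1), "`g ∈ ⋂_{p<∞} C([0,1]; W^{1,p}(T²))` such that `g^{ν_m} → g` in `C([0,1]; W^{1,p}(T²))`
  for any `p < ∞`": the limit slices `gLim t` are only Sobolev, so their derivatives are recorded as WEAK
  partial derivatives `Dg i t` (`FunctionSpaces.Torus.HasWeakPartialDeriv i (gLim t) (Dg i t)`, Evans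
  §5.2.1, `TorusTestFunction.lean`; integrability of `gLim t`, `Dg i t` is asserted so that the predicate is
  the honest one), and the convergence is
  `sup_{t∈[0,1]} (‖g_m(t) − gLim(t)‖_{L^p} + ∑ᵢ ‖∂ᵢ g_m(t) − Dg_i(t)‖_{L^p}) → 0` for every `p ∈ [1,∞)`
  (Mathlib's `eLpNorm` on `T²`, classical `FunctionSpaces.Torus.partialDeriv` of the smooth `g m t`; the
  `W^{1,p}` norm up to the immaterial equivalence constant between `∑ᵢ‖∂ᵢ·‖_p` and `‖∇·‖_p`). Membership
  `g ∈ C([0,1]; W^{1,p})` and the finiteness of the norms of `g(t)` are then automatic (uniform limit of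
  the continuous `W^{1,p}`-valued maps `t ↦ g_m(t)`), and are not restated.
* (3.5) is typed VERBATIM with the exponent `3/2`: `ν_m ∫₀¹∫_{T²}|∇θ^{ν_m}|² ≥ C exp{−log^{3/2}(1/ν_m)}`
  "for every `m ∈ ℕ`", "for some constant `C` independent of `m`" (`0 < C`). **Recorded discrepancy
  (not resolved here):** Theorem 1.2, of which Theorem 3.2 is announced as the "more precise version",
  prints the exponent `2/3` in (1.8) (`≥ C exp{−log^{2/3}(1/ν_m)}`, vendored verbatim as
  `BrueDeLellis2023_enhancedDissipation`); the proof (§8.2, (8.16) p. 18) delivers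
  `ν_m∫₀¹∫|∇θ^m|² ≥ C e^{−8m²}` with `ν_m ≤ e^{−2m³}` (`ν_m = λ_m² τ_m 5^{−2/τ_m}`, `λ_n = e^{−n}/100`,
  `τ_n = n^{−3}`, `γ_n = e^{−n²}`, (7.7)), i.e. a lower bound of the shape `exp(−c log^{2/3}(1/ν_m))`; since
  `exp{−log^{3/2}(1/ν)} ≤ exp{−log^{2/3}(1/ν)}` for `ν ≤ e^{−1}`, the printed (3.5) is the WEAKER of the
  two displays and does not imply (1.8). Both are vendored as printed; neither typed fact is used to
  derive the other.
* NOT vendored: the prose after Theorem 3.1 ("`v^{ν_m} ∈ C([0,1], C^α)` uniformly in `m`"; "in the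
  vanishing viscosity limit … `u = (v, θ)` with `v ∈ C([0,1], C^α)`, `θ ∈ L^∞`") and Remark 3.3 ((3.6),
  the logarithmic UPPER bound "following [BN19, Theorem 0.4]", printed as `≤ C(p) log^p(1/ν_m)`) —
  unnumbered claims resp. a remark proved by citation (Bruè–Nguyen), not theorems of the source.

## References

* E. Bruè, C. De Lellis, Comm. Math. Phys. 400 (2023) 1507–1533, arXiv:2207.06301v1, §3.1 p. 6:
  (3.1)–(3.3), ((2+½)-NS), Thm. 3.1 with (3.4), Thm. 3.2 with (3.5), Remark 3.3 with (3.6); §8.2 (8.16)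
  p. 18; (7.7) p. 14. [`BrueDeLellisCMP2023`]
-/

open MeasureTheory Set Filter Topology
open scoped NNReal ENNReal

noncomputable section

namespace Literature.Analysis.FluidPDE

section BrueDeLellisTwoHalfD

/-- **Bruè–De Lellis, Theorem 3.1** (Comm. Math. Phys. 400 (2023); arXiv:2207.06301v1 §3.1 p. 6),
verbatim: "There exist a sequence `ν_m ↓ 0`, `g^{ν_m} ∈ C^∞(T² × [0,1])`, and `v₀, θ₀ ∈ C^∞(T²)`
satisfying the following properties: (1) There exists `g ∈ ⋂_{α∈(0,1)} C([0,1]; C^α(T²))`, such that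
`g^{ν_m} → g` in `C([0,1]; C^α(T²))` for any `α ∈ (0,1)`. (2) The smooth solution
`v^{ν_m}, θ^m ∈ C^∞(T² × [0,1])` to ((2+½)-NS) [`∂ₜv + (v·∇)v + ∇q = ν_mΔv + g^{ν_m}`, `div v = 0`,
`∂ₜθ + v·∇θ = ν_mΔθ`, data `v(·,0) = v₀`, `θ(·,0) = θ₀` ((3.2)–(3.3))] displays anomalous dissipation,
i.e. `liminf_{m→∞} ν_m ∫₀¹∫_{T²} |∇θ^{ν_m}(x,t)|² dx dt > 0`. (3.4)" Rendering (module docstring):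
`IsVanishingViscosity ν`; (1) as a limit `gLim` with `C^{0,α}_b` slices, continuous in the `C^{0,α}` norm on
`[0,1]`, and `sup_{t∈[0,1]} ‖g_m(t) − gLim(t)‖_{C^{0,α}} → 0`, for every `α ∈ (0,1)`; (2) as a classical
planar Navier–Stokes solution from `v₀` plus a classical advection–diffusion solution from `θ₀`
(uniqueness not restated); (3.4) in the `ε`-eventually form with `Torus.scalarDissipation`.
[cite: BrueDeLellisCMP2023, Thm. 3.1 p. 6 (arXiv:2207.06301v1); (3.1)–(3.4)] -/
def BrueDeLellis2023_thm31 : Prop :=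
  ∃ (ν : ℕ → ℝ) (g : ℕ → ℝ → UnitAddTorus (Fin 2) → EuclideanSpace ℝ (Fin 2))
    (v₀ : UnitAddTorus (Fin 2) → EuclideanSpace ℝ (Fin 2)) (θ₀ : UnitAddTorus (Fin 2) → ℝ)
    (v : ℕ → ℝ → UnitAddTorus (Fin 2) → EuclideanSpace ℝ (Fin 2))
    (q θ : ℕ → ℝ → UnitAddTorus (Fin 2) → ℝ),
    IsVanishingViscosity ν ∧ FunctionSpaces.Torus.IsSmooth v₀ ∧ FunctionSpaces.Torus.IsSmooth θ₀ ∧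
    (∀ m, FunctionSpaces.Torus.IsSmoothSpaceTimeOn (Icc 0 1) (g m)) ∧
    -- (1): a limit force `g ∈ ⋂_{α ∈ (0,1)} C([0,1]; C^α(T²))`, `g^{ν_m} → g` in `C([0,1]; C^α(T²))`
    (∃ gLim : ℝ → UnitAddTorus (Fin 2) → EuclideanSpace ℝ (Fin 2), ∀ α : ℝ≥0, 0 < α → α < 1 →
      (∀ t ∈ Icc (0 : ℝ) 1, FunctionSpaces.MemBoundedHolder α (gLim t)) ∧
      FunctionSpaces.ContinuousInHolderOn (Icc 0 1) α gLim ∧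
      Tendsto (fun m => ⨆ t ∈ Icc (0 : ℝ) 1, FunctionSpaces.eBoundedHolderNorm α (g m t - gLim t))
        atTop (𝓝 0)) ∧
    -- (2): the smooth solution `(v^{ν_m}, θ^{ν_m})` of the planar system from `(v₀, θ₀)` …
    (∀ m, FunctionSpaces.Torus.IsClassicalNSSolutionOn (Icc 0 1) (ν m) (g m) (v m) (q m) ∧ v m 0 = v₀ ∧
      Torus.IsClassicalScalarTransportOn (Icc 0 1) (ν m) (v m) (θ m) ∧ θ m 0 = θ₀) ∧
    -- … displays anomalous dissipation (3.4)
    ∃ ε : ℝ, 0 < ε ∧ ∀ᶠ m in atTop, ε ≤ Torus.scalarDissipation (ν m) (θ m) 0 1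

/-- **Bruè–De Lellis, Theorem 3.2** (Comm. Math. Phys. 400 (2023); arXiv:2207.06301v1 §3.1 p. 6),
verbatim: "There exist a sequence `ν_m ↓ 0`, `g^{ν_m} ∈ C^∞(T² × [0,1])`, and `v₀, θ₀ ∈ C^∞(T²)`
satisfying the following properties: (1) There exists `g ∈ ⋂_{p<∞} C([0,1]; W^{1,p}(T²))`, such that
`g^{ν_m} → g` in `C([0,1]; W^{1,p}(T²))` for any `p < ∞`. (2) The smooth solution
`v^{ν_m}, θ^m ∈ C^∞(T² × [0,1])` to ((2+½)-NS) satisfies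
`ν_m ∫₀¹∫_{T²} |∇θ^{ν_m}(x,t)|² dx dt ≥ C exp{−log^{3/2}(1/ν_m)}` for every `m ∈ ℕ`, (3.5) for some constant
`C` independent of `m`." Rendering (module docstring): `IsVanishingViscosity ν` with `ν m < 1`; (1) as a
limit `gLim` whose slices have integrable weak partial derivatives `Dg i t`
(`FunctionSpaces.Torus.HasWeakPartialDeriv`) with
`sup_{t∈[0,1]} (‖g_m(t) − gLim(t)‖_{L^p} + ∑ᵢ‖∂ᵢg_m(t) − Dg_i(t)‖_{L^p}) → 0` for every `p ∈ [1,∞)`; (2) as in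
`BrueDeLellis2023_thm31`; (3.5) with `0 < C`, `Real.rpow` and `Torus.scalarDissipation`, exponent `3/2`
AS PRINTED (Theorem 1.2 (1.8) prints `2/3`; see the module docstring — the two displays are not
interchangeable and neither typed fact is derived from the other).
[cite: BrueDeLellisCMP2023, Thm. 3.2 p. 6 (arXiv:2207.06301v1); (3.5)] -/
def BrueDeLellis2023_thm32 : Prop :=
  ∃ (ν : ℕ → ℝ) (g : ℕ → ℝ → UnitAddTorus (Fin 2) → EuclideanSpace ℝ (Fin 2))
    (v₀ : UnitAddTorus (Fin 2) → EuclideanSpace ℝ (Fin 2)) (θ₀ : UnitAddTorus (Fin 2) → ℝ)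
    (v : ℕ → ℝ → UnitAddTorus (Fin 2) → EuclideanSpace ℝ (Fin 2))
    (q θ : ℕ → ℝ → UnitAddTorus (Fin 2) → ℝ),
    IsVanishingViscosity ν ∧ (∀ m, ν m < 1) ∧
    FunctionSpaces.Torus.IsSmooth v₀ ∧ FunctionSpaces.Torus.IsSmooth θ₀ ∧
    (∀ m, FunctionSpaces.Torus.IsSmoothSpaceTimeOn (Icc 0 1) (g m)) ∧
    -- (1): a limit force `g ∈ ⋂_{p<∞} C([0,1]; W^{1,p}(T²))`, `g^{ν_m} → g` in `C([0,1]; W^{1,p}(T²))`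
    (∃ (gLim : ℝ → UnitAddTorus (Fin 2) → EuclideanSpace ℝ (Fin 2))
        (Dg : Fin 2 → ℝ → UnitAddTorus (Fin 2) → EuclideanSpace ℝ (Fin 2)),
      (∀ t ∈ Icc (0 : ℝ) 1, Integrable (gLim t) ∧ ∀ i, Integrable (Dg i t) ∧
        FunctionSpaces.Torus.HasWeakPartialDeriv i (gLim t) (Dg i t)) ∧
      ∀ p : ℝ≥0, 1 ≤ p →
        Tendsto (fun m => ⨆ t ∈ Icc (0 : ℝ) 1,
          (eLpNorm (g m t - gLim t) (p : ℝ≥0∞) volume +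
            ∑ i : Fin 2, eLpNorm (FunctionSpaces.Torus.partialDeriv i (g m t) - Dg i t) (p : ℝ≥0∞) volume))
          atTop (𝓝 0)) ∧
    -- (2): the smooth solution `(v^{ν_m}, θ^{ν_m})` of the planar system from `(v₀, θ₀)` …
    (∀ m, FunctionSpaces.Torus.IsClassicalNSSolutionOn (Icc 0 1) (ν m) (g m) (v m) (q m) ∧ v m 0 = v₀ ∧
      Torus.IsClassicalScalarTransportOn (Icc 0 1) (ν m) (v m) (θ m) ∧ θ m 0 = θ₀) ∧
    -- … satisfies the lower bound (3.5), as printed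
    ∃ C : ℝ, 0 < C ∧ ∀ m,
      C * Real.exp (-(Real.log (1 / ν m)) ^ (3 / 2 : ℝ)) ≤ Torus.scalarDissipation (ν m) (θ m) 0 1

end BrueDeLellisTwoHalfD

end Literature.Analysis.FluidPDE

end
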